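import Mathlib
import HarnessLib
import Summits.NavierStokesRegularity.NavierStokesRegularity.Theorems.UnthreadedDoorCellFluxWindowDecayDefs
import Summits.NavierStokesRegularity.NavierStokesRegularity.Theorems.UnthreadedDoorCellFluxWindowDecayTools
import Summits.NavierStokesRegularity.NavierStokesRegularity.Theorems.UnthreadedDoorIndicatrixViscosityStepAtSq
import Summits.NavierStokesRegularity.NavierStokesRegularity.Theorems.UnthreadedDoorNetFluxWindowDecayOffNull

/-!
# Route `UnthreadedDoor`, crux `PoloidalLiouville` (stmt-NavierStokesRegularity-1222), WALL W1 — crux idea «indicatrix-bound», Λ-3′: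
# window decay of the cumulative cluster flux on the COUNT-FREE stratum (the CORRECTED re-run of Λ-3)

★ `clusterFluxWindowDecayTame'_of : <Λ-2 `ClusterFluxOneSidedLawTame`> → <Λ-0′ `IndicatrixGrowthL2`> → ClusterFluxNearCentreLinked →
<Λ-geo‴ `AnalyticCellCountNearCentre`> → ClusterFluxWindowDecayTame'`, where **Λ-3′ `ClusterFluxWindowDecayTame'` = the registered Λ-3
`ClusterFluxWindowDecayTame` of `Cruxes/PoloidalLiouville/IndicatrixSketch.lean` v1.7.3 VERBATIM except binder 8** (= the v1.7.5 `ClusterFluxWindowDecayTame` body token-for-token, the custodian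
ns-idea-14 g13 having adopted the typing note at 15:12:45Z), which is the HESSIAN bound
`∀ t ∈ Ioo t₀ 0, ∀ x, ‖iteratedFDeriv ℝ 2 (v t) x‖ ≤ C₂ / Real.sqrt (-t) ^ 3` (what Λ-T′ `TypeIHessianBound`, p725408, delivers and what the growth Λ-0′
`IndicatrixGrowthL2` consumes) in place of the vorticity-gradient bound `‖fderiv ℝ (curl (v t)) x‖ ≤ C₂ / √(−t)^3` (from which Λ-0′ cannot be invoked:
ns-qj-p1 g8 typing note, bus 2026-08-29T14:46Z/15:14:59Z).  The AE-2′ antecedent of the registered stub is DROPPED: Λ-2 states the law at EVERY window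
time, so the PLAIN comparison `Literature.Analysis.FluidPDE.HalfLineOU.halfLineOU_decay_viscosity` (no Lipschitz-in-`s` hypothesis) applies — no
Σ-0e-type input is needed (erratum 15:14:59Z to the typing note).  IndicatrixSketch v1.7.6 (custodian ns-idea-14 g13, 15:29Z) RE-TYPED the Λ-3 stub to exactly
this antecedent list, so `stub_clusterFluxWindowDecayTame := Theorems.PoloidalLiouville.Indicatrix.clusterFluxWindowDecayTame'_of` closes it BY NAME.

Proof = the Σ-3′/AE-4′ argument with the quadratic a-priori bound: growth `0 ≤ F ≤ C_Λ C₂ r²/√(−t)³` on the whole slab (Λ-0′ at every `(t,r)`: slices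
`T t` analytic by `cellFinitePred`, classes with preconnected ranges), hence the CUBIC class `U ≤ (C_Λ C₂/3)(1+ρ)³` of the self-similar cumulative flux
(`window_primitive_leSq`); the law from Λ-2 applied to the rule; near-centre control from Σ-0b′ with its dense count from Λ-geo‴ (everywhere on
`[t₁,t₂] × (0,1)`); the viscosity inequality from `viscosity_inequality_window_atSq`; the plain OU comparison; integrability from `window_integrableOn_IocSq`.
Constant: `|A| C_Λ / 3` (so that `A (C_Λ C₂/3) ≤ |A| (C_Λ/3)(C₁ + C₂)`).  HONEST: bookkeeping under crux 1222; Λ-2, Λ-0′ (its Λ-0b+c half) and Σ-0b′ (its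
Σ-0bR₂ half) are OPEN; W1 movement 0; NS regularity NOT proved.  `--supports stmt-NavierStokesRegularity-1222 --as helper`.  [folklore]
-/

-- the summit and its single sub-problem share the name (CONVENTIONS §1)
set_option linter.dupNamespace false

noncomputable section

open Set Function Filter Topology MeasureTheory intervalIntegral
open scoped Topology

namespace Summit.NavierStokesRegularity.NavierStokesRegularity.Theorems.PoloidalLiouville.Indicatrix

open Summit.NavierStokesRegularity.NavierStokesRegularity.Theorems.PoloidalLiouville.NetFlux
  (E3 CurledLaw contDiff_slice_of_window contDiffOn_slice_compl setIntegral_Ioo_eq_intervalIntegral)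
open Summit.NavierStokesRegularity.NavierStokesRegularity.Theorems.PoloidalLiouville.CellFlux
  (sphCrit cellSet clusterFlux IsClusterPartition AdmissibleRule OneSidedLawFor cellFinitePred ClusterFluxNearCentreLinked
   clusterFlux_nonneg_of_partition)
open Literature.Analysis Literature.Analysis.FluidPDE

set_option maxHeartbeats 800000 in
/-- ★ **Λ-3′ (corrected Λ-3): window decay of the cumulative cluster flux on the count-free stratum**, from the law Λ-2, the count-free growth Λ-0′,
the near-centre control Σ-0b′ and the near-centre cell count Λ-geo‴ (all as hypotheses, bodies verbatim; the conclusion is Λ-3's body with binder 8 the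
Hessian bound). [folklore] -/
theorem clusterFluxWindowDecayTame'_of
    (h2 : ∀ (v : ℝ → E3 → E3) (x₀ : E3) (T P : ℝ → E3 → ℝ) (V : ℝ → ℝ) (t₀ : ℝ),
      ContDiffOn ℝ (⊤ : ℕ∞) (uncurry v) (Ioo t₀ 0 ×ˢ univ) →
      ContDiffOn ℝ (⊤ : ℕ∞) (uncurry T) (Ioo t₀ 0 ×ˢ ({x₀}ᶜ : Set E3)) →
      (∀ t ∈ Ioo t₀ 0, ContDiffOn ℝ 1 (P t) ({x₀}ᶜ : Set E3)) →
      (∀ t ∈ Ioo t₀ 0, ∀ x, ‖v t x‖ ≤ V t) →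
      (∀ t ∈ Ioo t₀ 0, ∀ x, x ≠ x₀ →
          cross (gradient (P t) x - (inner ℝ (v t x) (x - x₀)) • gradient (T t) x) (x - x₀) = 0) →
      (∀ t ∈ Ioo t₀ 0, ∀ x, curl (v t) x = cross (gradient (T t) x) (x - x₀)) →
      CurledLaw v x₀ T (Ioo t₀ 0) →
      (∀ t ∈ Ioo t₀ 0, cellFinitePred v x₀ T t) →
      ∀ 𝒞 : ℝ → ℝ → Set (Set E3), AdmissibleRule x₀ T P V t₀ 𝒞 →
        OneSidedLawFor (fun t r => clusterFlux (T t) r (𝒞 t r)) V t₀ (fun _ => True))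
    (h0 : ∃ C : ℝ, 0 ≤ C ∧ ∀ (u : E3 → E3) (x₀ : E3) (f : E3 → ℝ) (r K : ℝ) (𝒦 : Set (Set E3)), 0 < r →
      ContDiff ℝ 2 u → AnalyticOnNhd ℝ f ({x₀}ᶜ : Set E3) →
      (∀ x, curl u x = cross (gradient f x) (x - x₀)) →
      (∀ x ∈ Metric.sphere x₀ r, ‖iteratedFDeriv ℝ 2 u x‖ ≤ K) →
      IsClusterPartition f x₀ r 𝒦 → (∀ K ∈ 𝒦, IsPreconnected (f '' K)) →
      clusterFlux f r 𝒦 ≤ C * r ^ 2 * K)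
    (h3 : ClusterFluxNearCentreLinked)
    (hgeo : ∀ (v : ℝ → E3 → E3) (x₀ : E3) (T : ℝ → E3 → ℝ) (t₀ t₁ t₂ : ℝ), t₀ < t₁ → t₁ ≤ t₂ → t₂ < 0 →
      AnalyticOnNhd ℝ (uncurry v) (Ioo t₀ 0 ×ˢ (univ : Set E3)) →
      (∀ t ∈ Ioo t₀ 0, ∀ x, curl (v t) x = cross (gradient (T t) x) (x - x₀)) →
      ∃ N₀ : ℕ, ∀ t ∈ Icc t₁ t₂, ∀ a ∈ Ioo (0 : ℝ) 1, (cellSet (T t) x₀ a).Finite ∧ (cellSet (T t) x₀ a).ncard ≤ N₀) :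
    ∀ C : ℝ, 0 ≤ C → ∃ lam > (0 : ℝ), ∃ A : ℝ,
    ∀ (v : ℝ → E3 → E3) (x₀ : E3) (T P : ℝ → E3 → ℝ) (C₁ C₂ t₀ : ℝ), t₀ < 0 →
    ContDiffOn ℝ (⊤ : ℕ∞) (uncurry v) (Ioo t₀ 0 ×ˢ univ) →
    AnalyticOnNhd ℝ (uncurry v) (Ioo t₀ 0 ×ˢ (univ : Set E3)) →
    ContDiffOn ℝ (⊤ : ℕ∞) (uncurry T) (Ioo t₀ 0 ×ˢ ({x₀}ᶜ : Set E3)) →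
    (∀ t ∈ Ioo t₀ 0, ContDiffOn ℝ 1 (P t) ({x₀}ᶜ : Set E3)) →
    (∀ t ∈ Ioo t₀ 0, ∀ x, ‖v t x‖ ≤ C / Real.sqrt (-t)) →
    (∀ t ∈ Ioo t₀ 0, ∀ x, ‖curl (v t) x‖ ≤ C₁ / (-t)) →
    (∀ t ∈ Ioo t₀ 0, ∀ x, ‖iteratedFDeriv ℝ 2 (v t) x‖ ≤ C₂ / Real.sqrt (-t) ^ 3) →
    (∀ t ∈ Ioo t₀ 0, ∀ x, x ≠ x₀ →
        cross (gradient (P t) x - (inner ℝ (v t x) (x - x₀)) • gradient (T t) x) (x - x₀) = 0) →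
    (∀ t ∈ Ioo t₀ 0, ∀ x, curl (v t) x = cross (gradient (T t) x) (x - x₀)) →
    CurledLaw v x₀ T (Ioo t₀ 0) →
    (∀ t ∈ Ioo t₀ 0, cellFinitePred v x₀ T t) →
    ∀ 𝒞 : ℝ → ℝ → Set (Set E3), AdmissibleRule x₀ T P (fun t => C / Real.sqrt (-t)) t₀ 𝒞 →
    (∀ t ∈ Ioo t₀ 0, ∀ r > 0, ∀ K ∈ 𝒞 t r, IsPreconnected (T t '' K)) →
    ∀ t₁ t R : ℝ, t₀ < t₁ → t₁ ≤ t → t < 0 → 0 < R →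
      IntegrableOn (fun r => clusterFlux (T t) r (𝒞 t r)) (Ioo 0 R) ∧
      ∫ r in Ioo 0 R, clusterFlux (T t) r (𝒞 t r)
        ≤ A * (C₁ + C₂) * (1 + R / Real.sqrt (-t)) ^ 3 * (t / t₁) ^ lam := by
  intro C hC
  obtain ⟨lam, hlam, A, hOU⟩ := HalfLineOU.halfLineOU_decay_viscosity C hC
  obtain ⟨CΛ, hCΛ0, hΛ⟩ := h0
  refine ⟨lam, hlam, |A| * (CΛ / 3), ?_⟩
  intro v x₀ T P C₁ C₂ t₀ ht₀ hv hvan hT hP hvC hωC hHess hhead hlink hlaw hcell 𝒞 h𝒞 hpre t₁ t R ht₁ ht₁t ht hR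
  -- the window functional and its constant
  set K : ℝ := CΛ * C₂ with hK
  have ht₁mem : t₁ ∈ Ioo t₀ 0 := ⟨ht₁, lt_of_le_of_lt ht₁t ht⟩
  -- `0 ≤ C₁`, `0 ≤ C₂`
  have hC₁ : 0 ≤ C₁ := by
    have h0 : (0:ℝ) ≤ C₁ / (-t₁) := le_trans (norm_nonneg _) (hωC t₁ ht₁mem x₀)
    have hnt : 0 < -t₁ := by linarith [ht₁mem.2]
    by_contra hneg
    push Not at hneg
    have : C₁ / (-t₁) < 0 := div_neg_of_neg_of_pos hneg hnt
    linarith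
  have hC₂ : 0 ≤ C₂ := by
    have hnt : 0 < -t₁ := by linarith [ht₁mem.2]
    have hst : 0 < Real.sqrt (-t₁) ^ 3 := pow_pos (Real.sqrt_pos.2 hnt) 3
    have h0 : (0:ℝ) ≤ C₂ / Real.sqrt (-t₁) ^ 3 := le_trans (norm_nonneg _) (hHess t₁ ht₁mem x₀)
    by_contra hneg
    push Not at hneg
    have : C₂ / Real.sqrt (-t₁) ^ 3 < 0 := div_neg_of_neg_of_pos hneg hst
    linarith
  have hK0 : 0 ≤ K := by rw [hK]; positivity
  -- slices of the data
  have hvs : ∀ t' ∈ Ioo t₀ 0, ContDiff ℝ 2 (v t') := fun t' ht' =>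
    (contDiff_slice_of_window hv ht').of_le (WithTop.coe_le_coe.2 le_top)
  have hTs : ∀ t' ∈ Ioo t₀ 0, ContDiffOn ℝ 1 (T t') ({x₀}ᶜ : Set E3) := fun t' ht' =>
    (contDiffOn_slice_compl hT ht').of_le (by exact_mod_cast le_top)
  -- (1) the a-priori bound on the cluster-flux density (Λ-0′ at every point of the slab)
  have hbd : ∀ t' ∈ Ioo t₀ 0, ∀ r, 0 < r →
      0 ≤ clusterFlux (T t') r (𝒞 t' r) ∧ clusterFlux (T t') r (𝒞 t' r) ≤ K * r ^ 2 / Real.sqrt (-t') ^ 3 := by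
    intro t' ht' r hr
    refine ⟨clusterFlux_nonneg_of_partition hr (hTs t' ht') (h𝒞.1 t' ht' r hr), ?_⟩
    have h := hΛ (v t') x₀ (T t') r (C₂ / Real.sqrt (-t') ^ 3) (𝒞 t' r) hr (hvs t' ht') (hcell t' ht').2.1 (hlink t' ht')
      (fun x _ => hHess t' ht' x) (h𝒞.1 t' ht' r hr) (hpre t' ht' r hr)
    calc clusterFlux (T t') r (𝒞 t' r) ≤ CΛ * r ^ 2 * (C₂ / Real.sqrt (-t') ^ 3) := h
      _ = K * r ^ 2 / Real.sqrt (-t') ^ 3 := by rw [hK]; ring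
  -- (L) for these data and this rule (Λ-2), at every time
  obtain ⟨ℓp, ℓm, hcont, hℓp, hℓm, hlawL⟩ :=
    h2 v x₀ T P (fun s => C / Real.sqrt (-s)) t₀ hv hT hP hvC hhead hlink hlaw hcell 𝒞 h𝒞
  have hcont' : ContinuousOn (fun p : ℝ × ℝ => clusterFlux (T p.1) p.2 (𝒞 p.1 p.2)) (Ioo t₀ 0 ×ˢ Ioi 0) := hcont
  -- (NC) for these data and this rule (Σ-0b′, its count from Λ-geo‴)
  have hnc : ∀ t₁' t₂' : ℝ, t₀ < t₁' → t₁' ≤ t₂' → t₂' < 0 → ∃ κ : ℝ, 0 ≤ κ ∧ ∀ a₀ : ℝ, 0 < a₀ → a₀ ≤ 1 →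
      (∀ t' ∈ Icc t₁' t₂', (∀ a ∈ Ioo 0 a₀, clusterFlux (T t') a (𝒞 t' a) ≤ κ * a ^ 2) ∧
        LipschitzOnWith (Real.toNNReal (κ * a₀)) (fun r => clusterFlux (T t') r (𝒞 t' r)) (Ioo 0 a₀)) ∧
      (∀ t' ∈ Icc t₁' t₂', ∀ t'' ∈ Icc t₁' t₂', ∀ a ∈ Ioo 0 a₀,
        |clusterFlux (T t') a (𝒞 t' a) - clusterFlux (T t'') a (𝒞 t'' a)| ≤ κ * a ^ 2 * |t' - t''|) := by
    intro t₁' t₂' h1 h2 h3'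
    obtain ⟨N₀, hN₀⟩ := hgeo v x₀ T t₀ t₁' t₂' h1 h2 h3' hvan hlink
    refine h3 v x₀ T P (fun s => C / Real.sqrt (-s)) N₀ t₀ t₁' t₂' h1 h2 h3' hv hT hlink ?_ 𝒞 h𝒞
    intro p hp
    refine subset_closure ⟨⟨h1.trans_le hp.1.1, lt_of_le_of_lt hp.1.2 h3'⟩, hp.2.1, hN₀ p.1 hp.1 p.2 hp.2⟩
  -- (2) the self-similar cumulative flux `U`
  set s₁ : ℝ := -Real.log (-t₁) with hs₁
  have hnt₁ : 0 < -t₁ := by linarith [ht₁mem.2]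
  have hτs₁ : -Real.exp (-s₁) = t₁ := by rw [hs₁, neg_neg, Real.exp_log hnt₁, neg_neg]
  have hτ : ∀ s, s₁ ≤ s → -Real.exp (-s) ∈ Ioo t₀ 0 := fun s hs => by
    refine ⟨?_, neg_neg_of_pos (Real.exp_pos _)⟩
    have h1 : Real.exp (-s) ≤ Real.exp (-s₁) := Real.exp_le_exp.2 (by linarith)
    linarith [hτs₁]
  obtain ⟨U, hU⟩ : ∃ U : ℝ → ℝ → ℝ, ∀ s ρ,
      U s ρ = ∫ r in (0:ℝ)..(ρ * Real.exp (-s / 2)), clusterFlux (T (-Real.exp (-s))) r (𝒞 (-Real.exp (-s)) r) :=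
    ⟨fun s ρ => ∫ r in (0:ℝ)..(ρ * Real.exp (-s / 2)), clusterFlux (T (-Real.exp (-s))) r (𝒞 (-Real.exp (-s)) r),
      fun _ _ => rfl⟩
  have hW := continuousOn_window_primitiveSq (w := fun t' r => clusterFlux (T t') r (𝒞 t' r)) (t₀ := t₀) (K := K)
    hcont' hbd
  have hUcont : ContinuousOn (uncurry U) (Ici s₁ ×ˢ Ici 0) := by
    have hmap : Continuous (fun q : ℝ × ℝ => ((-Real.exp (-q.1), q.2 * Real.exp (-q.1 / 2)) : ℝ × ℝ)) := by
      fun_prop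
    have hmaps : MapsTo (fun q : ℝ × ℝ => ((-Real.exp (-q.1), q.2 * Real.exp (-q.1 / 2)) : ℝ × ℝ))
        (Ici s₁ ×ˢ Ici 0) (Ioo t₀ 0 ×ˢ Ici 0) :=
      fun q hq => ⟨hτ q.1 hq.1, mul_nonneg hq.2 (Real.exp_pos _).le⟩
    have hcomp := hW.comp hmap.continuousOn hmaps
    have heq : uncurry U = (fun p : ℝ × ℝ => ∫ r in (0:ℝ)..p.2, clusterFlux (T p.1) r (𝒞 p.1 r)) ∘
        (fun q : ℝ × ℝ => ((-Real.exp (-q.1), q.2 * Real.exp (-q.1 / 2)) : ℝ × ℝ)) := by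
      funext q
      simp only [Function.comp_apply, Function.uncurry_def]
      rw [hU]
    rw [heq]
    exact hcomp
  have hU0 : ∀ s, s₁ ≤ s → U s 0 ≤ 0 := fun s _ => by rw [hU]; simp
  have hUgr : ∀ s, s₁ ≤ s → ∀ ρ, 0 ≤ ρ → U s ρ ≤ K / 3 * (1 + ρ) ^ 3 := by
    intro s hs ρ hρ
    rw [hU]
    have hb := window_primitive_leSq (w := fun t' r => clusterFlux (T t') r (𝒞 t' r)) (t₀ := t₀) (K := K)
      hcont' hbd (hτ s hs) (R := ρ * Real.exp (-s / 2)) (mul_nonneg hρ (Real.exp_pos _).le)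
    have he : Real.sqrt (-(-Real.exp (-s))) = Real.exp (-s / 2) := by
      rw [neg_neg, Real.sqrt_eq_rpow, ← Real.exp_mul]
      congr 1; ring
    have hepos : 0 < Real.exp (-s / 2) := Real.exp_pos _
    have hval : K / Real.sqrt (-(-Real.exp (-s))) ^ 3 * (ρ * Real.exp (-s / 2)) ^ 3 / 3 = K / 3 * ρ ^ 3 := by
      rw [he, mul_pow]; field_simp
    have hρ3 : ρ ^ 3 ≤ (1 + ρ) ^ 3 := pow_le_pow_left₀ hρ (by linarith) 3
    calc ∫ r in (0:ℝ)..(ρ * Real.exp (-s / 2)), clusterFlux (T (-Real.exp (-s))) r (𝒞 (-Real.exp (-s)) r)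
        ≤ K / 3 * ρ ^ 3 := hval ▸ hb
      _ ≤ K / 3 * (1 + ρ) ^ 3 := mul_le_mul_of_nonneg_left hρ3 (by positivity)
  -- (3) the viscosity inequality at EVERY touching time (the law holds at every time), and (4) the plain OU decay
  have key := hOU U s₁ (K / 3) hUcont hU0 hUgr (by positivity)
    (fun φ φₛ φ₁ φ₂ s₀ ρ₀ hs₀ hρ₀ hφs hφ1 hφ2 hmax =>
      viscosity_inequality_window_atSq (w := fun t' r => clusterFlux (T t') r (𝒞 t' r)) hC hcont' hbd hℓp hℓm hnc hU
        φ φₛ φ₁ φ₂ s₀ ρ₀ (hτ s₀ hs₀.le).1 hρ₀ (hlawL _ (hτ s₀ hs₀.le) trivial) hφs hφ1 hφ2 hmax)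
  -- back to `(t, R)`
  have hnt : 0 < -t := by linarith
  have htmem : t ∈ Ioo t₀ 0 := ⟨lt_of_lt_of_le ht₁ ht₁t, ht⟩
  set s : ℝ := -Real.log (-t) with hs
  have hss₁ : s₁ ≤ s := by
    rw [hs, hs₁]
    have := Real.log_le_log hnt (by linarith : -t ≤ -t₁)
    linarith
  have hτs : -Real.exp (-s) = t := by rw [hs, neg_neg, Real.exp_log hnt, neg_neg]
  have hsq : Real.exp (-s / 2) = Real.sqrt (-t) := by
    rw [hs, neg_neg, Real.sqrt_eq_rpow, Real.rpow_def_of_pos hnt]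
    congr 1; ring
  have hsqpos : 0 < Real.sqrt (-t) := Real.sqrt_pos.2 hnt
  have hρR : R / Real.sqrt (-t) * Real.exp (-s / 2) = R := by
    rw [hsq]; field_simp
  have hfin := key s hss₁ (R / Real.sqrt (-t)) (div_nonneg hR.le hsqpos.le)
  rw [hU, hρR, hτs] at hfin
  have hexp : Real.exp (-lam * (s - s₁)) = (t / t₁) ^ lam := by
    have hq : 0 < t / t₁ := div_pos_of_neg_of_neg ht (by linarith)
    rw [Real.rpow_def_of_pos hq, hs, hs₁]
    congr 1
    have : Real.log (t / t₁) = Real.log (-t) - Real.log (-t₁) := by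
      rw [← Real.log_div hnt.ne' hnt₁.ne', neg_div_neg_eq]
    rw [this]; ring
  rw [hexp] at hfin
  refine ⟨(window_integrableOn_IocSq hcont' hbd htmem R).mono_set Ioo_subset_Ioc_self, ?_⟩
  rw [setIntegral_Ioo_eq_intervalIntegral _ hR.le]
  -- the constants: `A (K/3) ≤ |A| (C_Λ/3) (C₁ + C₂)`
  have hX : 0 ≤ (1 + R / Real.sqrt (-t)) ^ 3 * (t / t₁) ^ lam := by
    have hq : 0 < t / t₁ := div_pos_of_neg_of_neg ht (by linarith)
    exact mul_nonneg (by positivity) (Real.rpow_nonneg hq.le _)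
  have hKle : K ≤ CΛ * (C₁ + C₂) := by rw [hK]; nlinarith
  calc ∫ r in (0:ℝ)..R, clusterFlux (T t) r (𝒞 t r)
      ≤ A * (K / 3) * (1 + R / Real.sqrt (-t)) ^ 3 * (t / t₁) ^ lam := hfin
    _ = (A * (K / 3)) * ((1 + R / Real.sqrt (-t)) ^ 3 * (t / t₁) ^ lam) := by ring
    _ ≤ (|A| * (CΛ * (C₁ + C₂) / 3)) * ((1 + R / Real.sqrt (-t)) ^ 3 * (t / t₁) ^ lam) := by
        apply mul_le_mul_of_nonneg_right _ hX
        calc A * (K / 3) ≤ |A| * (K / 3) := mul_le_mul_of_nonneg_right (le_abs_self A) (by positivity)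
          _ ≤ |A| * (CΛ * (C₁ + C₂) / 3) := by
              apply mul_le_mul_of_nonneg_left _ (abs_nonneg A)
              linarith
    _ = |A| * (CΛ / 3) * (C₁ + C₂) * (1 + R / Real.sqrt (-t)) ^ 3 * (t / t₁) ^ lam := by ring


end Summit.NavierStokesRegularity.NavierStokesRegularity.Theorems.PoloidalLiouville.Indicatrix

end
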